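import Literature.MathematicalPhysics.QuantumFieldTheory.Balaban1983to89.B13NodeTorusWalksGammaLeaves
import Literature.MathematicalPhysics.QuantumFieldTheory.Balaban1983to89.NodeOLettersOfWalksPerturbative

/-!
# `Balaban1983to89.B13NodeTorusWalksRefLeaves` — N10's WALKS LEAVES KEYED BY THE REFERENCE RUNG (₄ editions of
# `b13Leaf_twoTorus_walks₃` ∕ `b13Leaf_twoTorus_uniformWalksAcross₃` over `NodeOLettersOfWalksPerturbative.termWalks_of_ref_thresholds`
# ∕ `uniformWalksAcross_of_ref`: NODE A's displayed hypothesis in the currency of [13] Thm 3.10 expansions + positivity AT THE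
# REFERENCE CONFIGURATION)

statement-level bookkeeping over published theorems with citation tags; kernel-checked compositions of tree theorems; nothing here is
a claim about the Yang–Mills mass gap.

Cell `pub-ymgap`, D-0062 Track A, node N10 = [Balaban1988RG2Cluster] Lemmas 1–3; seat `dag-n10-c` g2 (FAN-OUT §N10 s3 lineage), module 9.
WHY.  After modules 1–8 of this seat (p451225 … p463673) N10's leaf triple on the two-scale torus is a theorem FROM NODE A's W-walks rung
`NodeOLettersOfWalksAcross.TermWalks (𝒦 Z t) q` per (2.14)-term (resp. `UniformWalksAcross 𝓣 q` across a family), with `hA`, `hcE`, `hΓq` and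
NODE O's exchange read off the rung.  That rung still asks, INSIDE its twelve clauses, for accretivity of the precisions `P` and `A2` AT EVERY
COMPLEX `(σ,u)` of polydisc × ball and for five volume sums — shapes print states no theorem of ([Balaban1988RG2Cluster] p. 15: *"For the
pair (U′, 0) the operators are symmetric, and the measure is positive, and then the estimates are simpler. The general case is handled by a
perturbative argument."*).  The -b seat's `NodeOLettersOfWalksPerturbative` (p454417) typed that perturbative argument at kernel level:
`termWalks_of_ref_thresholds : TermWalksRef 𝒦 r ⟹ TermWalks 𝒦 (r.toWalkPackage R₁)` under an accretivity radius `0 < R₁ < R` and four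
division-free thresholds, and the cell's discharge referee recorded (ref-B READ-365) that NODE A's honest residual for [B13] is the REFERENCE
rung `UniformWalksAcrossRef 𝓣_Bałaban r` — [13] Thm 3.10 expansions of `L`, `P`, `A2` + Thm 3.12-shape positivity of `P(0,0)`, `A2(0,0)`
+ geometry (far-ness of both location maps, multiplicities, dimension).  THIS FILE re-keys the two generic leaves to that currency, BY NAME.

WHAT (both `theorem`s; binders of the ₃ editions verbatim and in the same order except the rung block).
* `b13Leaf_twoTorus_walksRef` — `B13NodeTorusWalksGammaLeaves.b13Leaf_twoTorus_walks₃` with `(q) hq hp hη hη0 (rb : RateBook q) hκC hκCρ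
  (hαR : α < q.R) (hwalks : ∀ Z t, TermWalks (𝒦 Z t) q)` REPLACED by `(rf : RefPackage) hrf {R₁} hR₁ hR₁R` + the four thresholds
  `hPσ hP₁ hAσ hA₁` of `termWalks_of_ref_thresholds` + `hp hη` of `rf.toWalkPackage R₁` + `(rb : RateBook (rf.toWalkPackage R₁)) hκC hκCρ
  (hαR : α < R₁) (hwalks : ∀ Z, ∀ t ∈ terms, TermWalksRef (𝒦 Z t) rf)`; the elementary letters displayed in reference currency:
  `hKCs : 8∕m_{A,0} ≤ K₀′`, `hcE : 2∕m_{A,0} ≤ c_E` (the package's `m_A` is `m_{A,0}∕2`), `η = rf.η` (positive by `hrf.hη`: `hη0` dropped),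
  `c_V = rf.cV = n_B·c₀(1,η)^{d_m}`, `R_σ = rf.Rσ`; the derived letters `K̄`, `B_Γ` stay those of `rf.toWalkPackage R₁`.
* `b13Leaf_twoTorus_uniformWalksAcrossRef` — `…uniformWalksAcross₃` with `{q} (hall : UniformWalksAcross 𝓣 q)` REPLACED by
  `{rf} (hall : UniformWalksAcrossRef 𝓣 rf)`, the package block by `hrf R₁ hR₁ hR₁R` + the four thresholds + `hp hη`, `α < R₁`, print's two
  EXCHANGE thresholds at radius `R₁` with `K̄, μ, κ_C⋆` of `rf.toWalkPackage R₁` (as in the -b seat's `acrossSmall_of_ref_thresholds`).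
ORDER OF CHOICES (no circularity, `NodeOLettersOfWalksPerturbative` §6 + `NodeOLettersOfWalksAcross` §3): the reference package fixes
`(K̄, m₀, m_{A,0}, ε, n_B, d_m)` hence `c_V, c_V₀`; THEN `R_σ` large (σ-thresholds + the exchange threshold), `R₁` small (radius thresholds),
`η ≤ etaMax` (a function of the expansion constants only), `α ≤ θ₀R₁∕(4K̄+4)`.
What REMAINS by assertion after this file, on NODE A's side, per term: the reference datum `TermWalksRef (𝒦 Z t) rf` for BAŁABAN's kernels
([13] Thms 3.10 ∕ 3.12 — NODE A ∕ in-edge N06 ∕ the (D4) owner; NOT supplied), complex symmetry `hAs`, `hlin` (definitional), separate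
holomorphy `hΨσ ∕ hΨτ`, termwise domination `hH` (the dictionary); plus the located Lemma 1–2 inputs, the in-edges (1.24)∕(1.30), numbers.
NON-VACUITY of the reference rung across a family with ONE package: `NodeOLettersOfWalksPerturbativeWitness.uniformWalksAcrossRef_oneSiteFamily`
(p456213); of the q-keyed rung-side block jointly: `B13NodeTorusWalksRungWitness.rungBlock_oneSiteFamily_nonvacuous` (p459615).

CITATIONS.  [Balaban1988RG2Cluster] Lemmas 1–3 pp. 9, 11, 20; (1.11) p. 5, p. 13, p. 15, (2.7), (2.14)–(2.26) pp. 13–17.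
[Balaban1985BackgroundPropagators] Thm 3.10 ∕ (3.108) p. 416, Thm 3.12 p. 423, (3.154) p. 427.  [Balaban1984PropagatorsII] Lemma 2.1 (2.61) p. 234.

HONEST FRAMING: count-neutral Track-A side landing (kernel bookkeeping joining tree interfaces by name); N10 NOT discharged; NOTHING of
Bałaban's operators is constructed or asserted; NOT NODE O for Bałaban's family; NOT [B12] Thm 2; one finite T⁴ programme at fixed ε;
nothing continuum ∕ ℝ⁴ ∕ OS ∕ mass-gap ∕ Clay.  0 `sorry`, 0 `def`, no instance, no notation, standard axioms.
-/

noncomputable section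

namespace Literature.MathematicalPhysics.QuantumFieldTheory.Balaban1983to89.B13NodeTorusWalksRefLeaves

open Metric Set
open Literature.MathematicalPhysics.QuantumFieldTheory.Balaban1983to89
open Literature.MathematicalPhysics.QuantumFieldTheory.Balaban1983to89.B16Absorption (pbox)
open Literature.MathematicalPhysics.QuantumFieldTheory.Balaban1983to89.TreeLengthTorus
open Literature.MathematicalPhysics.QuantumFieldTheory.Balaban1983to89.TreeLengthTorusGeometry
open Literature.MathematicalPhysics.QuantumFieldTheory.Balaban1983to89.TreeLengthTorusTransfer
open Literature.MathematicalPhysics.QuantumFieldTheory.Balaban1983to89.B12TreeDecay (kappa₀ K₀)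
open Literature.MathematicalPhysics.QuantumFieldTheory.Balaban1983to89.B13Lemma3TorusData
open Literature.MathematicalPhysics.QuantumFieldTheory.Balaban1983to89.B13Lemma3Torus (TwoTorusStep)
open Literature.MathematicalPhysics.QuantumFieldTheory.Balaban1983to89.B13Lemma3TorusSocket (Lemma3Numerics)
open Literature.MathematicalPhysics.QuantumFieldTheory.Balaban1983to89.B13PkScaling (Qop scaled)
open Literature.MathematicalPhysics.QuantumFieldTheory.Balaban1983to89.DagBinding
open Literature.MathematicalPhysics.QuantumFieldTheory.Balaban1983to89.B13Bound143 (invTau R12)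
open Literature.MathematicalPhysics.QuantumFieldTheory.Balaban1983to89.B13Term214 (term214 SepHolOn core214 F214)
open Literature.MathematicalPhysics.QuantumFieldTheory.Balaban1983to89.B13Lemma3TorusTerms (terms weight Z0)
open Literature.MathematicalPhysics.QuantumFieldTheory.Balaban1983to89.B5TorusCover (UT)
open Literature.MathematicalPhysics.QuantumFieldTheory.Balaban1983to89.B9Thm37GlueTorus (tdist1)
open Literature.MathematicalPhysics.QuantumFieldTheory.Balaban1983to89.B13TermWalkData (TermKernels TorusTerms)
open Literature.MathematicalPhysics.QuantumFieldTheory.Balaban1983to89.NodeOLettersOfWalksAcross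
  (WalkPackage RateBook TermWalks UniformWalksAcross)
open Literature.MathematicalPhysics.QuantumFieldTheory.Balaban1983to89.NodeOLettersOfWalksPerturbative
  (RefPackage TermWalksRef UniformWalksAcrossRef termWalks_of_ref_thresholds uniformWalksAcross_of_ref margin_of_thresholds)
open Literature.MathematicalPhysics.QuantumFieldTheory.Balaban1983to89.B13NodeTorusWalksGammaLeaves
  (b13Leaf_twoTorus_walks₃ b13Leaf_twoTorus_uniformWalksAcross₃)

/-! ## §1. The per-term leaf keyed by the reference rung -/

section Walks

variable {L N' : ℕ} [NeZero L] [NeZero N']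

open Matrix

open Classical in
/-- **N10's LEAF TRIPLE ON THE TWO-SCALE TORUS FROM THE REFERENCE RUNG.**  Exactly
`B13NodeTorusWalksGammaLeaves.b13Leaf_twoTorus_walks₃` (p463673; same binders in the same order, same conclusion
`Lemma1Printed ∧ Lemma2Printed ∧ Lemma3Printed` for `Wt.toStepData`) except that NODE A's rung block is RE-KEYED to the reference
currency of `NodeOLettersOfWalksPerturbative` (p454417): the W-walks package `q` with `hq hp hη hη0`, its rate book and
`hwalks : ∀ Z t, TermWalks (𝒦 Z t) q` are REPLACED by an admissible REFERENCE package `rf` (`hrf`; named `rf` because `r` is the Cauchy radius of p. 15 in this binder list), an accretivity radius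
`0 < R₁ < R`, print's two perturbative sources as the four division-free thresholds of `termWalks_of_ref_thresholds`
(`8K̄_Pc_V₀e^{−ε_PR_σ} ≤ m₀`, `8K̄_Pc_V₀R₁ ≤ m₀R`, `8K̄_Ac_Ve^{−ε_AR_σ} ≤ m_{A,0}`, `8K̄_Ac_VR₁ ≤ m_{A,0}R`), positive input rates
and `η ≤ etaMax` of `rf.toWalkPackage R₁`, a rate book for it, and `hwalks : ∀ Z, ∀ t ∈ terms, TermWalksRef (𝒦 Z t) rf` — three
[13]-Thm-3.10 joint walk expansions + accretivity of `P(0,0)` and `A2(0,0)` AT THE REFERENCE CONFIGURATION ONLY + far-ness of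
both location maps + two multiplicities + `ν ≤ d_m`; letters in reference currency where elementary (`α < R₁`, `K₀′ ≥ 8∕m_{A,0}`,
`c_E ≥ 2∕m_{A,0}`, `g = (B_Γc_V)(B_Γ·m c₀(1,η)^ν)∕(m_{A,0}∕2)` with `B_Γ = (rf.toWalkPackage R₁).BΓ`, `c_V = rf.cV = n_Bc₀(1,η)^{d_m}`;
`η > 0` is `hrf.hη`, so `hη0` is dropped).  Proof: `b13Leaf_twoTorus_walks₃` at `q := rf.toWalkPackage R₁` with
`hwalks := termWalks_of_ref_thresholds` per term.  Accretivity at complex `(σ,u)`, the five volume sums, `Re A ≻ 0`, `spec C ≤ c_E`,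
the form bound of `Γ₀` and NODE O's (2.16) letters are thereby ALL tree theorems below the displayed hypothesis.
[cite: Balaban1988RG2Cluster, Lemmas 1–3 pp.9, 11, 20; p.13, p.15, (2.14)–(2.26) pp.15–17; Balaban1985BackgroundPropagators, Thm 3.10 p.416, Thm 3.12 p.423] -/
theorem b13Leaf_twoTorus_walksRef
    (Wt : TwoTorusStep 4 L N') (c : B13.Consts) (k : ℕ) (hN12 : 12 ≤ L * N') (hL8 : 8 ≤ c.L) (hLc : c.L = L)
    -- (1) LEMMA 1: index data of (1.33)
    (S0 : TDom 4 (L * N') → Finset (TPt 4 (L * N')))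
    (F : TDom 4 (L * N') → TPt 4 (L * N') → Finset (TPt 4 (L * N')))
    (Sq : TDom 4 (L * N') → TPt 4 (L * N') → (j : ℕ) → Finset (TPt 4 (L ^ (k - j) * (L * N'))))
    (SX : TDom 4 (L * N') → TPt 4 (L * N') → (j : ℕ) → TPt 4 (L ^ (k - j) * (L * N')) →
      Finset (TDom 4 (L ^ (k - j) * (L * N'))))
    (T : TDom 4 (L * N') → TPt 4 (L * N') → Finset (TPt 4 (L * N')) → (j : ℕ) →
      TPt 4 (L ^ (k - j) * (L * N')) → TDom 4 (L ^ (k - j) * (L * N')) → Wt.Φ → ℂ)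
    (Sc : TDom 4 (L * N') → Finset (TPt 4 (L * N')))
    (Sq' : TDom 4 (L * N') → TPt 4 (L * N') → (j : ℕ) → Finset (TPt 4 (L ^ (k - j) * (L * N'))))
    (SX' : TDom 4 (L * N') → TPt 4 (L * N') → (j : ℕ) → TPt 4 (L ^ (k - j) * (L * N')) →
      Finset (TDom 4 (L ^ (k - j) * (L * N'))))
    (T' : TDom 4 (L * N') → TPt 4 (L * N') → (j : ℕ) → TPt 4 (L ^ (k - j) * (L * N')) →
      TDom 4 (L ^ (k - j) * (L * N')) → Wt.Φ → ℂ)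
    (dist : TDom 4 (L * N') → TPt 4 (L * N') → (j : ℕ) → TPt 4 (L ^ (k - j) * (L * N')) → ℝ) {K K' : ℝ}
    (h133 : ∀ Y, Wt.Vp Y =
      (∑ a ∈ S0 Y, ∑ X ∈ (F Y a).powerset, ∑ j ∈ Finset.range (k + 1), ∑ q ∈ Sq Y a j,
        ∑ x ∈ SX Y a j q, T Y a X j q x) +
      (∑ a ∈ Sc Y, ∑ j ∈ Finset.range (k + 1), ∑ q ∈ Sq' Y a j, ∑ x ∈ SX' Y a j q, T' Y a j q x))
    (hS0Y : ∀ Y, ∀ a ∈ S0 Y,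
      (pbox (fun i => natLift a i - (5 : ℕ)) (fun i => natLift a i + 1 + (5 : ℕ))).image (proj (L * N')) ⊆ Y.1)
    (hFsub : ∀ Y a, F Y a ⊆
      (pbox (fun i => natLift a i - (5 : ℕ)) (fun i => natLift a i + 1 + (5 : ℕ))).image (proj (L * N')) \
        (pbox (fun i => natLift a i - (4 : ℕ)) (fun i => natLift a i + 1 + (4 : ℕ))).image (proj (L * N')))
    (hSq : ∀ Y, ∀ a ∈ S0 Y, ∀ j, Sq Y a j ⊆ (Finset.univ : Finset (TPt 4 (L ^ (k - j) * (L * N')))).filter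
      (fun q => tcoarse (L ^ (k - j)) (L * N') q ∈
        (pbox (fun i => natLift a i - (2 : ℕ)) (fun i => natLift a i + 1 + (2 : ℕ))).image (proj (L * N'))))
    (hScY : ∀ Y, Sc Y ⊆ Y.1)
    (hdist0 : ∀ Y a j q, 0 ≤ c.δ₀ * dist Y a j q)
    (hdist : ∀ Y a j (n : ℕ) q, q ∉ (pbox (fun i => ((L ^ (k - j) : ℕ) : ℤ) * natLift a i - (n + 1 : ℕ))
      (fun i => ((L ^ (k - j) : ℕ) : ℤ) * natLift a i + 2 * ((L ^ (k - j) : ℕ) : ℤ) - 1 + (n + 1 : ℕ))).image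
        (proj (L ^ (k - j) * (L * N'))) → c.δ₀ * c.M * ((n : ℝ) + 1) ≤ c.δ₀ * dist Y a j q)
    (hSX : ∀ Y a j q, SX Y a j q ⊆ (tcubeSys 4 (L ^ (k - j) * (L * N'))).above q)
    (hSX' : ∀ Y a j q, SX' Y a j q ⊆ (tcubeSys 4 (L ^ (k - j) * (L * N'))).above q)
    (hX0 : ∀ Y, ∀ a ∈ Sc Y, ∀ j ∈ Finset.range (k + 1), ∀ q ∈ Sq' Y a j, ∀ x ∈ SX' Y a j q,
      x.1.image (tcoarse (L ^ (k - j)) (L * N')) ⊆ Y.1)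
    -- (1) LEMMA 1: analyticity of the terms, closure of `Analytic`
    (hAdd : ∀ (s : Set Wt.Φ) (f g : Wt.Φ → ℂ), Wt.Analytic f s → Wt.Analytic g s → Wt.Analytic (f + g) s)
    (hZero : ∀ s : Set Wt.Φ, Wt.Analytic 0 s)
    (hAnT : ∀ Y, ∀ a ∈ S0 Y, ∀ X ∈ (F Y a).powerset, ∀ j ∈ Finset.range (k + 1), ∀ q ∈ Sq Y a j,
      ∀ x ∈ SX Y a j q, Wt.Analytic (T Y a X j q x) (Wt.sp1 Y))
    (hAnT' : ∀ Y, ∀ a ∈ Sc Y, ∀ j ∈ Finset.range (k + 1), ∀ q ∈ Sq' Y a j, ∀ x ∈ SX' Y a j q,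
      Wt.Analytic (T' Y a j q x) (Wt.sp1 Y))
    -- (1) LEMMA 1: thresholds and restrictions
    (hK : 0 ≤ K) (hK' : 0 ≤ K') (hκ : 0 ≤ c.κ) (hδ1 : c.δ < 1) (hδκ : 1 ≤ c.δ * c.κ)
    (hκ126 : kappa₀ 64 8 ≤ c.κ) (hκ126' : kappa₀ 64 8 ≤ c.δ * c.κ)
    (hκ₁ : 1 + 2 * Real.log (8 * 12 ^ 3) ≤ c.κ₁) (hκ₁' : 2 + 16 * Real.log 128 ≤ c.κ₁)
    (hδ₀M : 10 * Real.exp (-1) ≤ c.δ₀ * c.M) (hδ₀M5 : 2 * Real.log 5 ≤ c.δ₀ * c.M)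
    (hR8 : (1 - c.δ) * c.κ ≤ (1 / 4) * (c.κ₁ - 1)) (hR9 : (1 - 2 * c.δ) * c.κ ≤ (1 / 16) * c.κ₁)
    -- (1) LEMMA 1: per-term (1.24), (1.30) (IN-EDGES); the constants of (1.36) with headroom (1 − θ) for the local pieces
    (h124 : ∀ Y φ, φ ∈ Wt.sp1 Y → ∀ a ∈ S0 Y, ∀ X ∈ (F Y a).powerset, ∀ j ∈ Finset.range (k + 1), ∀ q ∈ Sq Y a j,
      ∀ x ∈ SX Y a j q,
        ‖T Y a X j q x φ‖ ≤ K * ((L : ℝ) ^ j * ((L : ℝ) ^ k)⁻¹) ^ 5 *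
          Real.exp (-(c.κ₁ - 1) *
            (((Y.1 \ (pbox (fun i => natLift a i - (5 : ℕ)) (fun i => natLift a i + 1 + (5 : ℕ))).image
              (proj (L * N'))).card : ℝ) + X.card)) *
          Real.exp (-(c.κ * torusTreeLen x.1)))
    (h130 : ∀ Y φ, φ ∈ Wt.sp1 Y → ∀ a ∈ Sc Y, ∀ j ∈ Finset.range (k + 1), ∀ q ∈ Sq' Y a j,
      ∀ x ∈ SX' Y a j q,
        ‖T' Y a j q x φ‖ ≤ K' * Real.exp (-(1 / 2) * (c.δ₀ * c.M) * ((L : ℝ) ^ j * ((L : ℝ) ^ k)⁻¹)⁻¹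
            - (1 / 2) * c.δ₀ * dist Y a j q) *
          Real.exp (-(c.κ₁ - 1) * ((Y.1 \ x.1.image (tcoarse (L ^ (k - j)) (L * N'))).card : ℝ)) *
          Real.exp (-(c.κ * torusTreeLen x.1)))
    {θ : ℝ} (hθ0 : 0 ≤ θ) (hθ1 : θ < 1)
    (hC : K * K₀ 64 8 * (2 * (6 * (L : ℝ)) ^ 4) * Real.exp 1 * Real.exp ((1 / 8) * c.κ₁ * (12 ^ 4 - 1)) +
        2 * (64 * K') * K₀ 64 8 * 1344 ≤
      (1 - θ) * (c.E₀ * c.ε₁ * c.C₁ * c.M ^ c.q * Real.exp (c.C₂ * c.κ₁)))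
    -- (2) LEMMA 2 (pp. 10–11): V″_k = V′_k + the local pieces G of P^{(k)}, analytic and (1.36)-small at prefactor θ
    (Gl : TDom 4 (L * N') → Wt.Φ → ℂ) (hVpp : ∀ Y, Wt.Vpp Y = fun φ => Wt.Vp Y φ + Gl Y φ)
    (hGlAn : ∀ Y, Wt.Analytic (Gl Y) (Wt.sp1 Y))
    (hGl : ∀ Y φ, φ ∈ Wt.sp1 Y → ‖Gl Y φ‖ ≤ θ * (c.E₀ * c.ε₁ * c.C₁ * c.M ^ c.q * Real.exp (c.C₂ * c.κ₁)) *
      Real.exp (-((1 - 2 * c.δ) * c.κ * (tsys 4 (L * N')).dj Y)))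
    -- (2) LEMMA 2: the located per-term data of `B13Lemma2Torus.lemma2Printed_twoTorus'`
    {E : Type*} [NormedAddCommGroup E] [NormedSpace ℂ E]
    (rd : TDom 4 (L * N') → Wt.Φ → E) (e : TDom 4 (L * N') → Wt.Bond → E) (he : ∀ Y b, ‖e Y b‖ ≤ 1)
    (hrd : ∀ Y φ, rd Y φ = haveI := Wt.finBond; ∑ b, Wt.Bv φ b • e Y b)
    {ι₂ : Type*} (s : TDom 4 (L * N') → Finset ι₂) (Wf : TDom 4 (L * N') → ι₂ → Wt.Φ → E → ℂ) {g : ℂ} (hg : g ≠ 0)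
    {R K₂ : ℝ} {m₂ : ℕ} (hK₂ : 0 ≤ K₂) (hR : 0 < R) (h3 : 3 * c.ε₁ ≤ R)
    (hW : ∀ Y, ∀ i ∈ s Y, ∀ φ ∈ Wt.sp1 Y, AnalyticOnNhd ℂ (Wf Y i φ) (ball 0 R))
    (hKW : ∀ Y, ∀ i ∈ s Y, ∀ φ ∈ Wt.sp1 Y, ∀ z ∈ ball (0 : E) R,
      ‖Wf Y i φ z‖ ≤ K₂ * Real.exp (-(c.κ₁ - 1) * ((Y.1.card : ℝ) - 1)) * ‖z‖ ^ 3)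
    (hcard : ∀ Y, (s Y).card ≤ m₂ * Y.1.card)
    (hV : ∀ Y, Wt.V Y = fun φ => (∑ i ∈ s Y, scaled g (Wf Y i φ) (rd Y φ)) + Wt.Vpp Y φ)
    (hQ : ∀ Y φ (b b' : Wt.Bond), φ ∈ Wt.sp1 Y →
      Wt.Q Y φ b b' = 2 * ∑ i ∈ s Y, Qop (scaled g (Wf Y i φ)) (rd Y φ) (e Y b) (e Y b'))
    (hsp : ∀ Y φ, φ ∈ Wt.sp1 Y → ‖g‖ * ‖rd Y φ‖ < c.ε₁)
    (hvolk : ∀ Y, Wt.volk Y = Y.1.card)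
    (hfloor : 27 * m₂ * K₂ * Real.exp (c.κ₁ - 1) ≤ c.C₃ * c.M ^ 4 * Real.exp (c.C₂ * c.κ₁))
    (hAnP : ∀ Y, ∀ i ∈ s Y, Wt.Analytic (fun φ => scaled g (Wf Y i φ) (rd Y φ)) (Wt.sp1 Y))
    (hG : ∀ Y, Wt.GaugeInv (Wt.V Y) ∧ Wt.GaugeInv (Wt.toStepData.quadForm Y) ∧ Wt.GaugeInv (Wt.Vpp Y))
    -- (3) LEMMA 3 (pp. 14–20): the signs of (2.18)–(2.20), R12, |τ(Y)| ≥ 2, and the numerics bundle at ℓ = ½L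
    (M₃ : ℕ) [NeZero M₃] {a a₂ a₂' a₅ Aabs : ℝ} (hN : Lemma3Numerics c M₃ ((c.L : ℝ) / 2) a a₂ a₂' a₅ Aabs)
    (h12 : R12 c) (hE : 0 < c.E₀) (hε : 0 < c.ε₁) (hC₁ : 0 < c.C₁) (hα : 0 < c.α₄) (hM : 1 ≤ c.M)
    (hτ2 : c.E₀ * c.ε₁ * c.C₁ * c.α₄⁻¹ * c.M ^ c.q * Real.exp (c.C₂ * c.κ₁) ≤ 1 / 2)
    -- (3) the Cauchy radius and the parameter domains (p. 15)
    {Uσ Uτ : Set ℂ} (hUσ : IsOpen Uσ) (hUτ : IsOpen Uτ) (hUexp : Metric.closedBall (0 : ℂ) (Real.exp c.κ₁) ⊆ Uσ)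
    (hUtau : ∀ Y : TDom 4 (L * N'), Metric.closedBall (0 : ℂ) ((invTau c ((tsys 4 (L * N')).dj Y))⁻¹) ⊆ Uτ)
    {r : ℝ} (hr : 0 < r) (hr' : r ≤ Real.exp c.κ₁ - 1)
    (hsubτ : ∀ x ∈ Set.uIcc (0 : ℝ) 1, Metric.closedBall (x : ℂ) r ⊆ Uτ)
    -- (3) THE DICTIONARY: per term (𝐃, P) of every Z ∈ 𝐃_{k+1}, the kernel data `𝒦 Z t` on a site torus `UT Nf` with
    --     configuration space `E₃`, and the configuration `u = uOf Z t φ` of `φ ∈ sp2 Z`, of size ≤ α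
    {ν : ℕ} {Nf : Fin ν → ℕ} [∀ i, NeZero (Nf i)]
    {E₃ : Type*} [NormedAddCommGroup E₃] [NormedSpace ℂ E₃]
    (𝒦 : TDom 4 N' → Finset (TDom 4 (L * N')) × Finset (TBond 4 M₃ (L * N')) → TermKernels c 4 N' ν Nf E₃)
    [∀ Z t, Fintype (𝒦 Z t).C₀] [∀ Z t, DecidableEq (𝒦 Z t).C₀]
    (uOf : (Z : TDom 4 N') → (t : Finset (TDom 4 (L * N')) × Finset (TBond 4 M₃ (L * N'))) → Wt.Φ → E₃)
    {α : ℝ} (hαnn : 0 ≤ α) (huα : ∀ Z, ∀ t ∈ terms L M₃ Z, ∀ φ ∈ Wt.sp2 Z, ‖uOf Z t φ‖ ≤ α)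
    -- (3) per term: parameter lists, the linear map Γ(σ), characteristic functions, potentials
    (lZ : TDom 4 N' → Finset (TDom 4 (L * N')) × Finset (TBond 4 M₃ (L * N')) → List (TPt 4 N'))
    (hlZ : ∀ Z, ∀ t ∈ terms L M₃ Z, (lZ Z t).Nodup ∧ (lZ Z t).toFinset = Z.1 \ tclosure L N' (Z0 M₃ t))
    (lD : TDom 4 N' → Finset (TDom 4 (L * N')) × Finset (TBond 4 M₃ (L * N')) → List (TDom 4 (L * N')))
    (hlD : ∀ Z, ∀ t ∈ terms L M₃ Z, (lD Z t).Nodup ∧ (lD Z t).toFinset = t.1)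
    (Γm : (Z : TDom 4 N') → (t : Finset (TDom 4 (L * N')) × Finset (TBond 4 M₃ (L * N'))) → Wt.Φ →
      (TPt 4 N' → ℂ) → ((𝒦 Z t).Λ ⊕ (𝒦 Z t).C₀ → ℝ) → ((𝒦 Z t).Λ → ℂ))
    (χY₀ χcP : (Z : TDom 4 N') → (t : Finset (TDom 4 (L * N')) × Finset (TBond 4 M₃ (L * N'))) →
      ((𝒦 Z t).Λ → ℝ) → ℝ)
    (hχ0 : ∀ Z t B, 0 ≤ χY₀ Z t B) (hχ1 : ∀ Z t B, χY₀ Z t B ≤ 1)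
    (Pl : (Z : TDom 4 N') → (t : Finset (TDom 4 (L * N')) × Finset (TBond 4 M₃ (L * N'))) → Finset (𝒦 Z t).Λ)
    (hPcard : ∀ Z, ∀ t ∈ terms L M₃ Z, (Pl Z t).card = t.2.card) {rP : ℝ} (hrP : 0 ≤ rP)
    (hχc : ∀ Z t B, χcP Z t B = ∏ b ∈ Pl Z t, (if rP ≤ |B b| then (1 : ℝ) else 0))
    (Dfam : TDom 4 N' → Finset (TDom 4 (L * N')) × Finset (TBond 4 M₃ (L * N')) → Finset (TDom 4 (L * N')))
    (Vr : (Z : TDom 4 N') → (t : Finset (TDom 4 (L * N')) × Finset (TBond 4 M₃ (L * N'))) → Wt.Φ →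
      TDom 4 (L * N') → ((𝒦 Z t).Λ → ℝ) → ℂ)
    -- (3) termwise domination: ‖H(Z)‖ ≤ Σ_{(𝐃,P)} ‖(2.14)‖ on the space of p. 15 ((2.9)/(2.14))
    (hH : ∀ (Z : TDom 4 N') (φ : Wt.Φ), φ ∈ Wt.sp2 Z → ‖Wt.H Z φ‖ ≤
      ∑ t ∈ terms L M₃ Z, ‖term214 r (lZ Z t) (lD Z t)
        (core214 (fun σ => (𝒦 Z t).A2 σ (uOf Z t φ)) (Γm Z t φ)
          (F214 t.2.card (χY₀ Z t) (χcP Z t) (Dfam Z t) (Vr Z t φ))) 0 0‖)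
    -- (3) the record's objects behind the terms: bonds, cubes, the real field inside the configurations
    (ιb : (Z : TDom 4 N') → (t : Finset (TDom 4 (L * N')) × Finset (TBond 4 M₃ (L * N'))) → (𝒦 Z t).Λ → Wt.Bond)
    (hι : ∀ Z t, Function.Injective (ιb Z t)) (cube : Wt.Bond → TPt 4 (L * N'))
    (hQsupp : ∀ (Y : TDom 4 (L * N')) φ b b', Wt.Q Y φ b b' ≠ 0 → cube b ∈ Y.1 ∧ cube b' ∈ Y.1)
    {m' : ℕ} (hfibc : ∀ Z t (x : TPt 4 (L * N')), (Finset.univ.filter fun j => cube (ιb Z t j) = x).card ≤ m')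
    (emb : (Z : TDom 4 N') → (t : Finset (TDom 4 (L * N')) × Finset (TBond 4 M₃ (L * N'))) → Wt.Φ →
      ((𝒦 Z t).Λ → ℝ) → Wt.Φ)
    (hBv : ∀ Z t φ B b, Wt.Bv (emb Z t φ B) (ιb Z t b) = (B b : ℂ))
    (hBv0 : ∀ Z t φ B b', b' ∉ Set.range (ιb Z t) → Wt.Bv (emb Z t φ B) b' = 0)
    (hVr : ∀ Z, ∀ t ∈ terms L M₃ Z, ∀ φ ∈ Wt.sp2 Z, ∀ Y ∈ Dfam Z t, ∀ B,
      emb Z t φ B ∈ Wt.sp1 Y → Vr Z t φ Y B = Wt.V Y (emb Z t φ B))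
    (hχsupp : ∀ Z, ∀ t ∈ terms L M₃ Z, ∀ φ ∈ Wt.sp2 Z, ∀ B, χY₀ Z t B ≠ 0 → ∀ Y ∈ Dfam Z t,
      emb Z t φ B ∈ Wt.sp1 Y)
    -- (3) separate holomorphy of the X-integral in (σ, τ)
    (hΨσ : ∀ Z, ∀ t ∈ terms L M₃ Z, ∀ φ ∈ Wt.sp2 Z, ∀ τ : TDom 4 (L * N') → ℂ, (∀ j, τ j ∈ Uτ) →
      SepHolOn Uσ (fun σ => core214 (fun σ => (𝒦 Z t).A2 σ (uOf Z t φ)) (Γm Z t φ)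
        (F214 t.2.card (χY₀ Z t) (χcP Z t) (Dfam Z t) (Vr Z t φ)) σ τ))
    (hΨτ : ∀ Z, ∀ t ∈ terms L M₃ Z, ∀ φ ∈ Wt.sp2 Z, ∀ σ : TPt 4 N' → ℂ, (∀ j, σ j ∈ Uσ) →
      SepHolOn Uτ (fun τ => core214 (fun σ => (𝒦 Z t).A2 σ (uOf Z t φ)) (Γm Z t φ)
        (F214 t.2.card (χY₀ Z t) (χcP Z t) (Dfam Z t) (Vr Z t φ)) σ τ))
    -- (3) NODE A's structural inputs at the configuration: A(σ) COMPLEX SYMMETRIC on the polydisc; Γ(σ) = G(σ)·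
    --     (`Re A(σ) ≻ 0` is no longer asked: it follows from the rung's m_A-accretivity, `re_posDef_of_termWalks`)
    (hAs : ∀ Z, ∀ t ∈ terms L M₃ Z, ∀ φ ∈ Wt.sp2 Z, ∀ σ : TPt 4 N' → ℂ, (∀ j, ‖σ j‖ ≤ Real.exp c.κ₁) →
      ((𝒦 Z t).A2 σ (uOf Z t φ)).IsSymm)
    (hlin : ∀ Z, ∀ t ∈ terms L M₃ Z, ∀ φ ∈ Wt.sp2 Z, ∀ σ : TPt 4 N' → ℂ, (∀ j, ‖σ j‖ ≤ Real.exp c.κ₁) →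
      ∀ X : (𝒦 Z t).Λ ⊕ (𝒦 Z t).C₀ → ℝ, Γm Z t φ σ X = (𝒦 Z t).G2 σ (uOf Z t φ) *ᵥ fun j => (X j : ℂ))
    {γ₂ : ℝ} (hγ₂ : 0 ≤ γ₂)
    -- (3) uniform fibre bounds of the bond locations
    {m : ℕ}
    (hfibΛ : ∀ Z t (x : UT Nf), (Finset.univ.filter fun i => (𝒦 Z t).locΛ i = x).card ≤ m)
    (hfibN : ∀ Z t (x : UT Nf), (Finset.univ.filter fun j => (𝒦 Z t).locN j = x).card ≤ m)
    -- (3) THE REFERENCE RUNG ON THE TERMS OF THE STEP (the displayed hypothesis, n10-b's reference currency): ONE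
    --     admissible reference package `r`, an accretivity radius `0 < R₁ < R`, print's two perturbative sources (p. 15:
    --     «O(1)e^{−⅓δ₀M} + O(α₀ + α₁)» against the reference positivity) as FOUR DIVISION-FREE THRESHOLDS, positive input
    --     rates and `η ≤ etaMax` of the W-walks package `rf.toWalkPackage R₁`, a rate book for it, `TermWalksRef` per term
    (rf : RefPackage) (hrf : rf.Admissible) {R₁ : ℝ} (hR₁ : 0 < R₁) (hR₁R : R₁ < rf.R)
    (hPσ : 8 * rf.KbarP * rf.cV₀ * Real.exp (-(rf.εP * rf.Rσ)) ≤ rf.m₀) (hP₁ : 8 * rf.KbarP * rf.cV₀ * R₁ ≤ rf.m₀ * rf.R)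
    (hAσ : 8 * rf.KbarA * rf.cV * Real.exp (-(rf.εA * rf.Rσ)) ≤ rf.mA₀) (hA₁ : 8 * rf.KbarA * rf.cV * R₁ ≤ rf.mA₀ * rf.R)
    (hp : (rf.toWalkPackage R₁).PositiveRates) (hη : rf.η ≤ (rf.toWalkPackage R₁).etaMax)
    (rb : RateBook (rf.toWalkPackage R₁)) (hκC : 0 < rb.κC) (hκCρ : rb.κC ≤ rb.ρ') (hαR : α < R₁)
    (hwalks : ∀ Z, ∀ t ∈ terms L M₃ Z, TermWalksRef (𝒦 Z t) rf)
    {KG KCs θ₀ : ℝ} (hKG : (rf.toWalkPackage R₁).Kbar ≤ KG) (hKCs : 8 / rf.mA₀ ≤ KCs)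
    (hθ : 2 * (rf.toWalkPackage R₁).Kbar * (Real.exp (-((rb.ρ' - rb.κC) * rf.Rσ)) + α / R₁) ≤ θ₀)
    -- (3) rates below the rate book's κ_C, and NODE A's letter ϑ (θ_Γ = θ_E = θ₀, K_Γ = K_G, K₀′ = K_Cs, θ_C derived)
    {kap kap' kap'' kap₂ ϑ : ℝ} (hkap'' : 0 < kap'') (hk1 : kap'' < kap') (hk2 : kap' < kap) (hk3 : kap < kap₂)
    (hk4 : kap₂ < rb.κC) (hθ₀le : θ₀ ≤ ϑ)
    (hθR1le : (m * (1 + 2 / (kap - kap')) ^ ν) * (m * (1 + 2 / (kap' - kap'')) ^ ν)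
      * (θ₀ * KCs * KG
        + KG * (KCs * θ₀ * (m * (1 + 2 / (rb.κC - kap₂)) ^ ν) * KCs * (m * (1 + 2 / (kap₂ - kap)) ^ ν)) * KG
        + KG * KCs * θ₀) ≤ ϑ)
    (hsmallKθ : KCs * (m * (1 + 2 / kap) ^ ν) * (ϑ * (m * (1 + 2 / kap'') ^ ν)) < 1)
    -- (3) the (2.24)–(2.25) smallness with `a₂₀ = m′·α₄·M⁻⁴(1 + 32/(κ₁−1))⁴`; the eigenvalue bound of C is the NUMBER
    --     `2∕m_{A,0} ≤ cE`; the form bound of Γ₀ is the NUMBER `g = B_Γ²c_V·m c₀(1,η)^ν∕(m_{A,0}∕2)`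
    {cE : ℝ} (hc0 : 0 ≤ cE)
    (hcE : 2 / rf.mA₀ ≤ cE)
    (hαc : (2 * (ϑ * (m * (1 + 2 / kap'') ^ ν)) +
      (γ₂ + m' * c.α₄ * (c.M ^ 4)⁻¹ * (1 + 32 / (c.κ₁ - 1)) ^ 4)) * cE ≤ 1 / 2)
    (hsmall : (2 * (ϑ * (m * (1 + 2 / kap'') ^ ν)) +
      (γ₂ + m' * c.α₄ * (c.M ^ 4)⁻¹ * (1 + 32 / (c.κ₁ - 1)) ^ 4)) * (1 + 2 * cE * (((rf.toWalkPackage R₁).BΓ * rf.cV) * ((rf.toWalkPackage R₁).BΓ * (m * B6.c0 1 rf.η ^ ν)) / (rf.mA₀ / 2))) ≤ 1 / 2)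
    -- (3) constant matching, p. 17: `a ≤ γ₂ r_P²` and the volume factor with `w = K₀(64,8)·α₄·#(⋃𝐃)`
    (hPa : a ≤ γ₂ * rP ^ 2)
    (hvol : ∀ Z, ∀ t ∈ terms L M₃ Z,
      2 * (KCs * (m * (1 + 2 / kap) ^ ν) * (ϑ * (m * (1 + 2 / kap'') ^ ν))
              * (1 + (1 - KCs * (m * (1 + 2 / kap) ^ ν) * (ϑ * (m * (1 + 2 / kap'') ^ ν)))⁻¹) / 2)
          * (Fintype.card (𝒦 Z t).Λ : ℝ)
        + K₀ 64 8 * c.α₄ * ((((Dfam Z t).image Subtype.val).biUnion id).card : ℝ)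
        + (2 * (ϑ * (m * (1 + 2 / kap'') ^ ν)) +
            (γ₂ + m' * c.α₄ * (c.M ^ 4)⁻¹ * (1 + 32 / (c.κ₁ - 1)) ^ 4)) * cE * (Fintype.card (𝒦 Z t).Λ : ℝ)
        + (2 * (ϑ * (m * (1 + 2 / kap'') ^ ν)) +
            (γ₂ + m' * c.α₄ * (c.M ^ 4)⁻¹ * (1 + 32 / (c.κ₁ - 1)) ^ 4)) * (1 + 2 * cE * (((rf.toWalkPackage R₁).BΓ * rf.cV) * ((rf.toWalkPackage R₁).BΓ * (m * B6.c0 1 rf.η ^ ν)) / (rf.mA₀ / 2)))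
            * (Fintype.card ((𝒦 Z t).Λ ⊕ (𝒦 Z t).C₀) : ℝ)
        ≤ a₅ * ((Z.1).card : ℝ)) :
    B13.Lemma1Printed Wt.toStepData c ∧ B13.Lemma2Printed Wt.toStepData c ∧ B13.Lemma3Printed Wt.toStepData c := by
  have hmA2 : (rf.toWalkPackage R₁).mA = rf.mA₀ / 2 := rfl
  have hKCs' : 4 / (rf.toWalkPackage R₁).mA ≤ KCs := by
    rw [hmA2, div_div_eq_mul_div]; norm_num; exact hKCs
  have hcE' : 1 / (rf.toWalkPackage R₁).mA ≤ cE := by rw [hmA2, one_div_div]; exact hcE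
  exact b13Leaf_twoTorus_walks₃ Wt c k hN12 hL8 hLc S0 F Sq SX T Sc Sq' SX' T' dist h133 hS0Y hFsub hSq hScY hdist0 hdist
    hSX hSX' hX0 hAdd hZero hAnT hAnT' hK hK' hκ hδ1 hδκ hκ126 hκ126' hκ₁ hκ₁' hδ₀M hδ₀M5 hR8 hR9 h124 h130 hθ0 hθ1 hC
    Gl hVpp hGlAn hGl rd e he hrd s Wf hg hK₂ hR h3 hW hKW hcard hV hQ hsp hvolk hfloor hAnP hG M₃ hN h12 hE hε hC₁ hα
    hM hτ2 hUσ hUτ hUexp hUtau hr hr' hsubτ 𝒦 uOf hαnn huα lZ hlZ lD hlD Γm χY₀ χcP hχ0 hχ1 Pl hPcard hrP hχc Dfam Vr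
    hH ιb hι cube hQsupp hfibc emb hBv hBv0 hVr hχsupp hΨσ hΨτ hAs hlin hγ₂ hfibΛ hfibN (rf.toWalkPackage R₁)
    (RefPackage.admissible_toWalkPackage hrf hR₁) hp hη hrf.hη rb hκC hκCρ hαR
    (fun Z t ht => termWalks_of_ref_thresholds hrf (hwalks Z t ht) hR₁ hR₁R hPσ hP₁ hAσ hA₁)
    hKG hKCs' hθ hkap'' hk1 hk2 hk3 hk4 hθ₀le hθR1le hsmallKθ hc0 hcE' hαc hsmall hPa hvol

end Walks

/-! ## §2. The FAN-OUT s3 shape keyed by `UniformWalksAcrossRef 𝓣 r` -/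

section Across

variable {L : ℕ} [NeZero L]

open Matrix

open Classical in
/-- **N10's LEAF TRIPLE FROM THE DISPLAYED HYPOTHESIS `UniformWalksAcrossRef 𝓣 r` — the FAN-OUT §N10 s3 shape in the REFERENCE
currency.**  Exactly `B13NodeTorusWalksGammaLeaves.b13Leaf_twoTorus_uniformWalksAcross₃` (p463673) except: `{q} (hall : UniformWalksAcross 𝓣 q)`
REPLACED by `{rf : RefPackage} (hall : UniformWalksAcrossRef 𝓣 rf)` (ONE reference package for every term of every member: the three
expansions, reference positivity, far-ness, multiplicities, dimension); the package block `hq hp hη hη0 hαR` REPLACED by `hrf`, the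
accretivity radius `0 < R₁ < R`, the four perturbative thresholds, `hp hη` of `rf.toWalkPackage R₁`, `α < R₁`; print's two EXCHANGE
thresholds read at radius `R₁` (`α ≤ θ₀R₁∕(4K̄+4)`, `log((4K̄+4)∕θ₀)∕(μ∕4 − κ_C⋆) ≤ R_σ` with `K̄, μ, κ_C⋆` of `rf.toWalkPackage R₁`);
`K₀′ ≥ 8∕m_{A,0}`, `c_E ≥ 2∕m_{A,0}`, `g` as in `b13Leaf_twoTorus_walksRef`.  Proof: `…uniformWalksAcross₃` at
`hall := uniformWalksAcross_of_ref hrf hall …` (the two margins by `margin_of_thresholds`).  What is NOT supplied: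
`UniformWalksAcrossRef 𝓣_Bałaban r` for BAŁABAN's family ([13] Thms 3.10 ∕ 3.12 at his kernels; NODE A ∕ in-edge N06).
[cite: Balaban1988RG2Cluster, Lemmas 1–3 pp.9, 11, 20; (1.11) p.5, p.13, p.15, (2.14)–(2.26) pp.15–17; Balaban1985BackgroundPropagators, Thm 3.10 p.416, Thm 3.12 p.423] -/
theorem b13Leaf_twoTorus_uniformWalksAcrossRef
    (c : B13.Consts) {S : Type*} (𝓣 : S → TorusTerms c 4) {rf : RefPackage} (hall : UniformWalksAcrossRef 𝓣 rf)
    (s₀ : S) [NeZero (𝓣 s₀).N'] (Wt : TwoTorusStep 4 L (𝓣 s₀).N') (k : ℕ) (hN12 : 12 ≤ L * (𝓣 s₀).N') (hL8 : 8 ≤ c.L) (hLc : c.L = L)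
    -- (1) LEMMA 1: index data of (1.33)
    (S0 : TDom 4 (L * (𝓣 s₀).N') → Finset (TPt 4 (L * (𝓣 s₀).N')))
    (F : TDom 4 (L * (𝓣 s₀).N') → TPt 4 (L * (𝓣 s₀).N') → Finset (TPt 4 (L * (𝓣 s₀).N')))
    (Sq : TDom 4 (L * (𝓣 s₀).N') → TPt 4 (L * (𝓣 s₀).N') → (j : ℕ) → Finset (TPt 4 (L ^ (k - j) * (L * (𝓣 s₀).N'))))
    (SX : TDom 4 (L * (𝓣 s₀).N') → TPt 4 (L * (𝓣 s₀).N') → (j : ℕ) → TPt 4 (L ^ (k - j) * (L * (𝓣 s₀).N')) →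
      Finset (TDom 4 (L ^ (k - j) * (L * (𝓣 s₀).N'))))
    (T : TDom 4 (L * (𝓣 s₀).N') → TPt 4 (L * (𝓣 s₀).N') → Finset (TPt 4 (L * (𝓣 s₀).N')) → (j : ℕ) →
      TPt 4 (L ^ (k - j) * (L * (𝓣 s₀).N')) → TDom 4 (L ^ (k - j) * (L * (𝓣 s₀).N')) → Wt.Φ → ℂ)
    (Sc : TDom 4 (L * (𝓣 s₀).N') → Finset (TPt 4 (L * (𝓣 s₀).N')))
    (Sq' : TDom 4 (L * (𝓣 s₀).N') → TPt 4 (L * (𝓣 s₀).N') → (j : ℕ) → Finset (TPt 4 (L ^ (k - j) * (L * (𝓣 s₀).N'))))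
    (SX' : TDom 4 (L * (𝓣 s₀).N') → TPt 4 (L * (𝓣 s₀).N') → (j : ℕ) → TPt 4 (L ^ (k - j) * (L * (𝓣 s₀).N')) →
      Finset (TDom 4 (L ^ (k - j) * (L * (𝓣 s₀).N'))))
    (T' : TDom 4 (L * (𝓣 s₀).N') → TPt 4 (L * (𝓣 s₀).N') → (j : ℕ) → TPt 4 (L ^ (k - j) * (L * (𝓣 s₀).N')) →
      TDom 4 (L ^ (k - j) * (L * (𝓣 s₀).N')) → Wt.Φ → ℂ)
    (dist : TDom 4 (L * (𝓣 s₀).N') → TPt 4 (L * (𝓣 s₀).N') → (j : ℕ) → TPt 4 (L ^ (k - j) * (L * (𝓣 s₀).N')) → ℝ) {K K' : ℝ}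
    (h133 : ∀ Y, Wt.Vp Y =
      (∑ a ∈ S0 Y, ∑ X ∈ (F Y a).powerset, ∑ j ∈ Finset.range (k + 1), ∑ q ∈ Sq Y a j,
        ∑ x ∈ SX Y a j q, T Y a X j q x) +
      (∑ a ∈ Sc Y, ∑ j ∈ Finset.range (k + 1), ∑ q ∈ Sq' Y a j, ∑ x ∈ SX' Y a j q, T' Y a j q x))
    (hS0Y : ∀ Y, ∀ a ∈ S0 Y,
      (pbox (fun i => natLift a i - (5 : ℕ)) (fun i => natLift a i + 1 + (5 : ℕ))).image (proj (L * (𝓣 s₀).N')) ⊆ Y.1)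
    (hFsub : ∀ Y a, F Y a ⊆
      (pbox (fun i => natLift a i - (5 : ℕ)) (fun i => natLift a i + 1 + (5 : ℕ))).image (proj (L * (𝓣 s₀).N')) \
        (pbox (fun i => natLift a i - (4 : ℕ)) (fun i => natLift a i + 1 + (4 : ℕ))).image (proj (L * (𝓣 s₀).N')))
    (hSq : ∀ Y, ∀ a ∈ S0 Y, ∀ j, Sq Y a j ⊆ (Finset.univ : Finset (TPt 4 (L ^ (k - j) * (L * (𝓣 s₀).N')))).filter
      (fun q => tcoarse (L ^ (k - j)) (L * (𝓣 s₀).N') q ∈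
        (pbox (fun i => natLift a i - (2 : ℕ)) (fun i => natLift a i + 1 + (2 : ℕ))).image (proj (L * (𝓣 s₀).N'))))
    (hScY : ∀ Y, Sc Y ⊆ Y.1)
    (hdist0 : ∀ Y a j q, 0 ≤ c.δ₀ * dist Y a j q)
    (hdist : ∀ Y a j (n : ℕ) q, q ∉ (pbox (fun i => ((L ^ (k - j) : ℕ) : ℤ) * natLift a i - (n + 1 : ℕ))
      (fun i => ((L ^ (k - j) : ℕ) : ℤ) * natLift a i + 2 * ((L ^ (k - j) : ℕ) : ℤ) - 1 + (n + 1 : ℕ))).image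
        (proj (L ^ (k - j) * (L * (𝓣 s₀).N'))) → c.δ₀ * c.M * ((n : ℝ) + 1) ≤ c.δ₀ * dist Y a j q)
    (hSX : ∀ Y a j q, SX Y a j q ⊆ (tcubeSys 4 (L ^ (k - j) * (L * (𝓣 s₀).N'))).above q)
    (hSX' : ∀ Y a j q, SX' Y a j q ⊆ (tcubeSys 4 (L ^ (k - j) * (L * (𝓣 s₀).N'))).above q)
    (hX0 : ∀ Y, ∀ a ∈ Sc Y, ∀ j ∈ Finset.range (k + 1), ∀ q ∈ Sq' Y a j, ∀ x ∈ SX' Y a j q,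
      x.1.image (tcoarse (L ^ (k - j)) (L * (𝓣 s₀).N')) ⊆ Y.1)
    -- (1) LEMMA 1: analyticity of the terms, closure of `Analytic`
    (hAdd : ∀ (s : Set Wt.Φ) (f g : Wt.Φ → ℂ), Wt.Analytic f s → Wt.Analytic g s → Wt.Analytic (f + g) s)
    (hZero : ∀ s : Set Wt.Φ, Wt.Analytic 0 s)
    (hAnT : ∀ Y, ∀ a ∈ S0 Y, ∀ X ∈ (F Y a).powerset, ∀ j ∈ Finset.range (k + 1), ∀ q ∈ Sq Y a j,
      ∀ x ∈ SX Y a j q, Wt.Analytic (T Y a X j q x) (Wt.sp1 Y))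
    (hAnT' : ∀ Y, ∀ a ∈ Sc Y, ∀ j ∈ Finset.range (k + 1), ∀ q ∈ Sq' Y a j, ∀ x ∈ SX' Y a j q,
      Wt.Analytic (T' Y a j q x) (Wt.sp1 Y))
    -- (1) LEMMA 1: thresholds and restrictions
    (hK : 0 ≤ K) (hK' : 0 ≤ K') (hκ : 0 ≤ c.κ) (hδ1 : c.δ < 1) (hδκ : 1 ≤ c.δ * c.κ)
    (hκ126 : kappa₀ 64 8 ≤ c.κ) (hκ126' : kappa₀ 64 8 ≤ c.δ * c.κ)
    (hκ₁ : 1 + 2 * Real.log (8 * 12 ^ 3) ≤ c.κ₁) (hκ₁' : 2 + 16 * Real.log 128 ≤ c.κ₁)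
    (hδ₀M : 10 * Real.exp (-1) ≤ c.δ₀ * c.M) (hδ₀M5 : 2 * Real.log 5 ≤ c.δ₀ * c.M)
    (hR8 : (1 - c.δ) * c.κ ≤ (1 / 4) * (c.κ₁ - 1)) (hR9 : (1 - 2 * c.δ) * c.κ ≤ (1 / 16) * c.κ₁)
    -- (1) LEMMA 1: per-term (1.24), (1.30) (IN-EDGES); the constants of (1.36) with headroom (1 − θ) for the local pieces
    (h124 : ∀ Y φ, φ ∈ Wt.sp1 Y → ∀ a ∈ S0 Y, ∀ X ∈ (F Y a).powerset, ∀ j ∈ Finset.range (k + 1), ∀ q ∈ Sq Y a j,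
      ∀ x ∈ SX Y a j q,
        ‖T Y a X j q x φ‖ ≤ K * ((L : ℝ) ^ j * ((L : ℝ) ^ k)⁻¹) ^ 5 *
          Real.exp (-(c.κ₁ - 1) *
            (((Y.1 \ (pbox (fun i => natLift a i - (5 : ℕ)) (fun i => natLift a i + 1 + (5 : ℕ))).image
              (proj (L * (𝓣 s₀).N'))).card : ℝ) + X.card)) *
          Real.exp (-(c.κ * torusTreeLen x.1)))
    (h130 : ∀ Y φ, φ ∈ Wt.sp1 Y → ∀ a ∈ Sc Y, ∀ j ∈ Finset.range (k + 1), ∀ q ∈ Sq' Y a j,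
      ∀ x ∈ SX' Y a j q,
        ‖T' Y a j q x φ‖ ≤ K' * Real.exp (-(1 / 2) * (c.δ₀ * c.M) * ((L : ℝ) ^ j * ((L : ℝ) ^ k)⁻¹)⁻¹
            - (1 / 2) * c.δ₀ * dist Y a j q) *
          Real.exp (-(c.κ₁ - 1) * ((Y.1 \ x.1.image (tcoarse (L ^ (k - j)) (L * (𝓣 s₀).N'))).card : ℝ)) *
          Real.exp (-(c.κ * torusTreeLen x.1)))
    {θ : ℝ} (hθ0 : 0 ≤ θ) (hθ1 : θ < 1)
    (hC : K * K₀ 64 8 * (2 * (6 * (L : ℝ)) ^ 4) * Real.exp 1 * Real.exp ((1 / 8) * c.κ₁ * (12 ^ 4 - 1)) +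
        2 * (64 * K') * K₀ 64 8 * 1344 ≤
      (1 - θ) * (c.E₀ * c.ε₁ * c.C₁ * c.M ^ c.q * Real.exp (c.C₂ * c.κ₁)))
    -- (2) LEMMA 2 (pp. 10–11): V″_k = V′_k + the local pieces G of P^{(k)}, analytic and (1.36)-small at prefactor θ
    (Gl : TDom 4 (L * (𝓣 s₀).N') → Wt.Φ → ℂ) (hVpp : ∀ Y, Wt.Vpp Y = fun φ => Wt.Vp Y φ + Gl Y φ)
    (hGlAn : ∀ Y, Wt.Analytic (Gl Y) (Wt.sp1 Y))
    (hGl : ∀ Y φ, φ ∈ Wt.sp1 Y → ‖Gl Y φ‖ ≤ θ * (c.E₀ * c.ε₁ * c.C₁ * c.M ^ c.q * Real.exp (c.C₂ * c.κ₁)) *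
      Real.exp (-((1 - 2 * c.δ) * c.κ * (tsys 4 (L * (𝓣 s₀).N')).dj Y)))
    -- (2) LEMMA 2: the located per-term data of `B13Lemma2Torus.lemma2Printed_twoTorus'`
    {E : Type*} [NormedAddCommGroup E] [NormedSpace ℂ E]
    (rd : TDom 4 (L * (𝓣 s₀).N') → Wt.Φ → E) (e : TDom 4 (L * (𝓣 s₀).N') → Wt.Bond → E) (he : ∀ Y b, ‖e Y b‖ ≤ 1)
    (hrd : ∀ Y φ, rd Y φ = haveI := Wt.finBond; ∑ b, Wt.Bv φ b • e Y b)
    {ι₂ : Type*} (s : TDom 4 (L * (𝓣 s₀).N') → Finset ι₂) (Wf : TDom 4 (L * (𝓣 s₀).N') → ι₂ → Wt.Φ → E → ℂ) {g : ℂ} (hg : g ≠ 0)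
    {R K₂ : ℝ} {m₂ : ℕ} (hK₂ : 0 ≤ K₂) (hR : 0 < R) (h3 : 3 * c.ε₁ ≤ R)
    (hW : ∀ Y, ∀ i ∈ s Y, ∀ φ ∈ Wt.sp1 Y, AnalyticOnNhd ℂ (Wf Y i φ) (ball 0 R))
    (hKW : ∀ Y, ∀ i ∈ s Y, ∀ φ ∈ Wt.sp1 Y, ∀ z ∈ ball (0 : E) R,
      ‖Wf Y i φ z‖ ≤ K₂ * Real.exp (-(c.κ₁ - 1) * ((Y.1.card : ℝ) - 1)) * ‖z‖ ^ 3)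
    (hcard : ∀ Y, (s Y).card ≤ m₂ * Y.1.card)
    (hV : ∀ Y, Wt.V Y = fun φ => (∑ i ∈ s Y, scaled g (Wf Y i φ) (rd Y φ)) + Wt.Vpp Y φ)
    (hQ : ∀ Y φ (b b' : Wt.Bond), φ ∈ Wt.sp1 Y →
      Wt.Q Y φ b b' = 2 * ∑ i ∈ s Y, Qop (scaled g (Wf Y i φ)) (rd Y φ) (e Y b) (e Y b'))
    (hsp : ∀ Y φ, φ ∈ Wt.sp1 Y → ‖g‖ * ‖rd Y φ‖ < c.ε₁)
    (hvolk : ∀ Y, Wt.volk Y = Y.1.card)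
    (hfloor : 27 * m₂ * K₂ * Real.exp (c.κ₁ - 1) ≤ c.C₃ * c.M ^ 4 * Real.exp (c.C₂ * c.κ₁))
    (hAnP : ∀ Y, ∀ i ∈ s Y, Wt.Analytic (fun φ => scaled g (Wf Y i φ) (rd Y φ)) (Wt.sp1 Y))
    (hG : ∀ Y, Wt.GaugeInv (Wt.V Y) ∧ Wt.GaugeInv (Wt.toStepData.quadForm Y) ∧ Wt.GaugeInv (Wt.Vpp Y))
    -- (3) LEMMA 3 (pp. 14–20): the signs of (2.18)–(2.20), R12, |τ(Y)| ≥ 2, and the numerics bundle at ℓ = ½L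
    (M₃ : ℕ) [NeZero M₃] {a a₂ a₂' a₅ Aabs : ℝ} (hN : Lemma3Numerics c M₃ ((c.L : ℝ) / 2) a a₂ a₂' a₅ Aabs)
    (h12 : R12 c) (hE : 0 < c.E₀) (hε : 0 < c.ε₁) (hC₁ : 0 < c.C₁) (hα : 0 < c.α₄) (hM : 1 ≤ c.M)
    (hτ2 : c.E₀ * c.ε₁ * c.C₁ * c.α₄⁻¹ * c.M ^ c.q * Real.exp (c.C₂ * c.κ₁) ≤ 1 / 2)
    -- (3) the Cauchy radius and the parameter domains (p. 15)
    {Uσ Uτ : Set ℂ} (hUσ : IsOpen Uσ) (hUτ : IsOpen Uτ) (hUexp : Metric.closedBall (0 : ℂ) (Real.exp c.κ₁) ⊆ Uσ)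
    (hUtau : ∀ Y : TDom 4 (L * (𝓣 s₀).N'),
      Metric.closedBall (0 : ℂ) ((invTau c ((tsys 4 (L * (𝓣 s₀).N')).dj Y))⁻¹) ⊆ Uτ)
    {r : ℝ} (hr : 0 < r) (hr' : r ≤ Real.exp c.κ₁ - 1)
    (hsubτ : ∀ x ∈ Set.uIcc (0 : ℝ) 1, Metric.closedBall (x : ℂ) r ⊆ Uτ)
    -- (3) THE DICTIONARY: the (2.14)-term (𝐃, P) = t of Z ∈ 𝐃_{k+1} is the term `idx Z t` of the member `s₀` (its
    --     extra columns finite), read at the configuration `u = uOf Z t φ ∈ (𝓣 s₀).E` of `φ ∈ sp2 Z`, of size ≤ α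
    (idx : TDom 4 (𝓣 s₀).N' → Finset (TDom 4 (L * (𝓣 s₀).N')) × Finset (TBond 4 M₃ (L * (𝓣 s₀).N')) → (𝓣 s₀).ι)
    [∀ Z t, Fintype ((𝓣 s₀).𝒦 (idx Z t)).C₀] [∀ Z t, DecidableEq ((𝓣 s₀).𝒦 (idx Z t)).C₀]
    (uOf : (Z : TDom 4 (𝓣 s₀).N') → (t : Finset (TDom 4 (L * (𝓣 s₀).N')) × Finset (TBond 4 M₃ (L * (𝓣 s₀).N'))) →
      Wt.Φ → (𝓣 s₀).E)
    {α : ℝ} (hαnn : 0 ≤ α) (huα : ∀ Z, ∀ t ∈ terms L M₃ Z, ∀ φ ∈ Wt.sp2 Z, ‖uOf Z t φ‖ ≤ α)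
    -- (3) per term: parameter lists, the linear map Γ(σ), characteristic functions, potentials
    (lZ : TDom 4 (𝓣 s₀).N' → Finset (TDom 4 (L * (𝓣 s₀).N')) × Finset (TBond 4 M₃ (L * (𝓣 s₀).N')) →
      List (TPt 4 (𝓣 s₀).N'))
    (hlZ : ∀ Z, ∀ t ∈ terms L M₃ Z, (lZ Z t).Nodup ∧ (lZ Z t).toFinset = Z.1 \ tclosure L (𝓣 s₀).N' (Z0 M₃ t))
    (lD : TDom 4 (𝓣 s₀).N' → Finset (TDom 4 (L * (𝓣 s₀).N')) × Finset (TBond 4 M₃ (L * (𝓣 s₀).N')) →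
      List (TDom 4 (L * (𝓣 s₀).N')))
    (hlD : ∀ Z, ∀ t ∈ terms L M₃ Z, (lD Z t).Nodup ∧ (lD Z t).toFinset = t.1)
    (Γm : (Z : TDom 4 (𝓣 s₀).N') → (t : Finset (TDom 4 (L * (𝓣 s₀).N')) × Finset (TBond 4 M₃ (L * (𝓣 s₀).N'))) → Wt.Φ →
      (TPt 4 (𝓣 s₀).N' → ℂ) → (((𝓣 s₀).𝒦 (idx Z t)).Λ ⊕ ((𝓣 s₀).𝒦 (idx Z t)).C₀ → ℝ) → (((𝓣 s₀).𝒦 (idx Z t)).Λ → ℂ))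
    (χY₀ χcP : (Z : TDom 4 (𝓣 s₀).N') → (t : Finset (TDom 4 (L * (𝓣 s₀).N')) × Finset (TBond 4 M₃ (L * (𝓣 s₀).N'))) →
      (((𝓣 s₀).𝒦 (idx Z t)).Λ → ℝ) → ℝ)
    (hχ0 : ∀ Z t B, 0 ≤ χY₀ Z t B) (hχ1 : ∀ Z t B, χY₀ Z t B ≤ 1)
    (Pl : (Z : TDom 4 (𝓣 s₀).N') → (t : Finset (TDom 4 (L * (𝓣 s₀).N')) × Finset (TBond 4 M₃ (L * (𝓣 s₀).N'))) → Finset ((𝓣 s₀).𝒦 (idx Z t)).Λ)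
    (hPcard : ∀ Z, ∀ t ∈ terms L M₃ Z, (Pl Z t).card = t.2.card) {rP : ℝ} (hrP : 0 ≤ rP)
    (hχc : ∀ Z t B, χcP Z t B = ∏ b ∈ Pl Z t, (if rP ≤ |B b| then (1 : ℝ) else 0))
    (Dfam : TDom 4 (𝓣 s₀).N' → Finset (TDom 4 (L * (𝓣 s₀).N')) × Finset (TBond 4 M₃ (L * (𝓣 s₀).N')) → Finset (TDom 4 (L * (𝓣 s₀).N')))
    (Vr : (Z : TDom 4 (𝓣 s₀).N') → (t : Finset (TDom 4 (L * (𝓣 s₀).N')) × Finset (TBond 4 M₃ (L * (𝓣 s₀).N'))) → Wt.Φ →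
      TDom 4 (L * (𝓣 s₀).N') → (((𝓣 s₀).𝒦 (idx Z t)).Λ → ℝ) → ℂ)
    -- (3) termwise domination: ‖H(Z)‖ ≤ Σ_{(𝐃,P)} ‖(2.14)‖ on the space of p. 15 ((2.9)/(2.14))
    (hH : ∀ (Z : TDom 4 (𝓣 s₀).N') (φ : Wt.Φ), φ ∈ Wt.sp2 Z → ‖Wt.H Z φ‖ ≤
      ∑ t ∈ terms L M₃ Z, ‖term214 r (lZ Z t) (lD Z t)
        (core214 (fun σ => ((𝓣 s₀).𝒦 (idx Z t)).A2 σ (uOf Z t φ)) (Γm Z t φ)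
          (F214 t.2.card (χY₀ Z t) (χcP Z t) (Dfam Z t) (Vr Z t φ))) 0 0‖)
    -- (3) the record's objects behind the terms: bonds, cubes, the real field inside the configurations
    (ιb : (Z : TDom 4 (𝓣 s₀).N') → (t : Finset (TDom 4 (L * (𝓣 s₀).N')) × Finset (TBond 4 M₃ (L * (𝓣 s₀).N'))) → ((𝓣 s₀).𝒦 (idx Z t)).Λ → Wt.Bond)
    (hι : ∀ Z t, Function.Injective (ιb Z t)) (cube : Wt.Bond → TPt 4 (L * (𝓣 s₀).N'))
    (hQsupp : ∀ (Y : TDom 4 (L * (𝓣 s₀).N')) φ b b', Wt.Q Y φ b b' ≠ 0 → cube b ∈ Y.1 ∧ cube b' ∈ Y.1)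
    {m' : ℕ} (hfibc : ∀ Z t (x : TPt 4 (L * (𝓣 s₀).N')), (Finset.univ.filter fun j => cube (ιb Z t j) = x).card ≤ m')
    (emb : (Z : TDom 4 (𝓣 s₀).N') → (t : Finset (TDom 4 (L * (𝓣 s₀).N')) × Finset (TBond 4 M₃ (L * (𝓣 s₀).N'))) → Wt.Φ →
      (((𝓣 s₀).𝒦 (idx Z t)).Λ → ℝ) → Wt.Φ)
    (hBv : ∀ Z t φ B b, Wt.Bv (emb Z t φ B) (ιb Z t b) = (B b : ℂ))
    (hBv0 : ∀ Z t φ B b', b' ∉ Set.range (ιb Z t) → Wt.Bv (emb Z t φ B) b' = 0)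
    (hVr : ∀ Z, ∀ t ∈ terms L M₃ Z, ∀ φ ∈ Wt.sp2 Z, ∀ Y ∈ Dfam Z t, ∀ B,
      emb Z t φ B ∈ Wt.sp1 Y → Vr Z t φ Y B = Wt.V Y (emb Z t φ B))
    (hχsupp : ∀ Z, ∀ t ∈ terms L M₃ Z, ∀ φ ∈ Wt.sp2 Z, ∀ B, χY₀ Z t B ≠ 0 → ∀ Y ∈ Dfam Z t,
      emb Z t φ B ∈ Wt.sp1 Y)
    -- (3) separate holomorphy of the X-integral in (σ, τ)
    (hΨσ : ∀ Z, ∀ t ∈ terms L M₃ Z, ∀ φ ∈ Wt.sp2 Z, ∀ τ : TDom 4 (L * (𝓣 s₀).N') → ℂ, (∀ j, τ j ∈ Uτ) →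
      SepHolOn Uσ (fun σ => core214 (fun σ => ((𝓣 s₀).𝒦 (idx Z t)).A2 σ (uOf Z t φ)) (Γm Z t φ)
        (F214 t.2.card (χY₀ Z t) (χcP Z t) (Dfam Z t) (Vr Z t φ)) σ τ))
    (hΨτ : ∀ Z, ∀ t ∈ terms L M₃ Z, ∀ φ ∈ Wt.sp2 Z, ∀ σ : TPt 4 (𝓣 s₀).N' → ℂ, (∀ j, σ j ∈ Uσ) →
      SepHolOn Uτ (fun τ => core214 (fun σ => ((𝓣 s₀).𝒦 (idx Z t)).A2 σ (uOf Z t φ)) (Γm Z t φ)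
        (F214 t.2.card (χY₀ Z t) (χcP Z t) (Dfam Z t) (Vr Z t φ)) σ τ))
    -- (3) NODE A's structural inputs at the configuration: A(σ) COMPLEX SYMMETRIC on the polydisc; Γ(σ) = G(σ)·
    (hAs : ∀ Z, ∀ t ∈ terms L M₃ Z, ∀ φ ∈ Wt.sp2 Z, ∀ σ : TPt 4 (𝓣 s₀).N' → ℂ, (∀ j, ‖σ j‖ ≤ Real.exp c.κ₁) →
      (((𝓣 s₀).𝒦 (idx Z t)).A2 σ (uOf Z t φ)).IsSymm)
    (hlin : ∀ Z, ∀ t ∈ terms L M₃ Z, ∀ φ ∈ Wt.sp2 Z, ∀ σ : TPt 4 (𝓣 s₀).N' → ℂ, (∀ j, ‖σ j‖ ≤ Real.exp c.κ₁) →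
      ∀ X : ((𝓣 s₀).𝒦 (idx Z t)).Λ ⊕ ((𝓣 s₀).𝒦 (idx Z t)).C₀ → ℝ, Γm Z t φ σ X = ((𝓣 s₀).𝒦 (idx Z t)).G2 σ (uOf Z t φ) *ᵥ fun j => (X j : ℂ))
    {γ₂ : ℝ} (hγ₂ : 0 ≤ γ₂)
    -- (3) uniform fibre bounds of the bond locations
    {m : ℕ}
    (hfibΛ : ∀ Z t (x : UT (𝓣 s₀).Nf), (Finset.univ.filter fun i => ((𝓣 s₀).𝒦 (idx Z t)).locΛ i = x).card ≤ m)
    (hfibN : ∀ Z t (x : UT (𝓣 s₀).Nf), (Finset.univ.filter fun j => ((𝓣 s₀).𝒦 (idx Z t)).locN j = x).card ≤ m)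
    -- (3) THE REFERENCE RUNG's PACKAGE: admissible, an accretivity radius `0 < R₁ < R` with print's two perturbative
    --     sources as FOUR DIVISION-FREE THRESHOLDS, positive input rates and `η ≤ etaMax` of `rf.toWalkPackage R₁` (standard
    --     rate book: `κ_C = κ_C⋆`, `ρ′ = μ/4`), `α < R₁`, round letters, and PRINT's TWO EXCHANGE THRESHOLDS for a `θ₀ > 0`
    (hrf : rf.Admissible) {R₁ : ℝ} (hR₁ : 0 < R₁) (hR₁R : R₁ < rf.R)
    (hPσ : 8 * rf.KbarP * rf.cV₀ * Real.exp (-(rf.εP * rf.Rσ)) ≤ rf.m₀) (hP₁ : 8 * rf.KbarP * rf.cV₀ * R₁ ≤ rf.m₀ * rf.R)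
    (hAσ : 8 * rf.KbarA * rf.cV * Real.exp (-(rf.εA * rf.Rσ)) ≤ rf.mA₀) (hA₁ : 8 * rf.KbarA * rf.cV * R₁ ≤ rf.mA₀ * rf.R)
    (hp : (rf.toWalkPackage R₁).PositiveRates) (hη : rf.η ≤ (rf.toWalkPackage R₁).etaMax) (hαR : α < R₁)
    {KG KCs θ₀ : ℝ} (hKG : (rf.toWalkPackage R₁).Kbar ≤ KG) (hKCs : 8 / rf.mA₀ ≤ KCs) (hθ₀ : 0 < θ₀)
    (hαsmall : α ≤ θ₀ * R₁ / (4 * (rf.toWalkPackage R₁).Kbar + 4))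
    (hRσlarge : Real.log ((4 * (rf.toWalkPackage R₁).Kbar + 4) / θ₀)
      / ((rf.toWalkPackage R₁).mu / 4 - (rf.toWalkPackage R₁).kapCStar) ≤ rf.Rσ)
    -- (3) rates below the package's κ_C⋆, and NODE A's letter ϑ (θ_Γ = θ_E = θ₀, K_Γ = K_G, K₀′ = K_Cs, θ_C derived)
    {kap kap' kap'' kap₂ ϑ : ℝ} (hkap'' : 0 < kap'') (hk1 : kap'' < kap') (hk2 : kap' < kap) (hk3 : kap < kap₂)
    (hk4 : kap₂ < (rf.toWalkPackage R₁).kapCStar) (hθ₀le : θ₀ ≤ ϑ)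
    (hθR1le : (m * (1 + 2 / (kap - kap')) ^ (𝓣 s₀).ν) * (m * (1 + 2 / (kap' - kap'')) ^ (𝓣 s₀).ν)
      * (θ₀ * KCs * KG
        + KG * (KCs * θ₀ * (m * (1 + 2 / ((rf.toWalkPackage R₁).kapCStar - kap₂)) ^ (𝓣 s₀).ν) * KCs
          * (m * (1 + 2 / (kap₂ - kap)) ^ (𝓣 s₀).ν)) * KG
        + KG * KCs * θ₀) ≤ ϑ)
    (hsmallKθ : KCs * (m * (1 + 2 / kap) ^ (𝓣 s₀).ν) * (ϑ * (m * (1 + 2 / kap'') ^ (𝓣 s₀).ν)) < 1)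
    -- (3) the (2.24)–(2.25) smallness with `a₂₀ = m′·α₄·M⁻⁴(1 + 32/(κ₁−1))⁴`; `2∕m_{A,0} ≤ cE`; the form bound of Γ₀
    {cE : ℝ} (hc0 : 0 ≤ cE)
    (hcE : 2 / rf.mA₀ ≤ cE)
    (hαc : (2 * (ϑ * (m * (1 + 2 / kap'') ^ (𝓣 s₀).ν)) +
      (γ₂ + m' * c.α₄ * (c.M ^ 4)⁻¹ * (1 + 32 / (c.κ₁ - 1)) ^ 4)) * cE ≤ 1 / 2)
    (hsmall : (2 * (ϑ * (m * (1 + 2 / kap'') ^ (𝓣 s₀).ν)) +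
      (γ₂ + m' * c.α₄ * (c.M ^ 4)⁻¹ * (1 + 32 / (c.κ₁ - 1)) ^ 4)) * (1 + 2 * cE * (((rf.toWalkPackage R₁).BΓ * rf.cV) * ((rf.toWalkPackage R₁).BΓ * (m * B6.c0 1 rf.η ^ (𝓣 s₀).ν)) / (rf.mA₀ / 2))) ≤ 1 / 2)
    -- (3) constant matching, p. 17: `a ≤ γ₂ r_P²` and the volume factor with `w = K₀(64,8)·α₄·#(⋃𝐃)`
    (hPa : a ≤ γ₂ * rP ^ 2)
    (hvol : ∀ Z, ∀ t ∈ terms L M₃ Z,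
      2 * (KCs * (m * (1 + 2 / kap) ^ (𝓣 s₀).ν) * (ϑ * (m * (1 + 2 / kap'') ^ (𝓣 s₀).ν))
              * (1 + (1 - KCs * (m * (1 + 2 / kap) ^ (𝓣 s₀).ν) * (ϑ * (m * (1 + 2 / kap'') ^ (𝓣 s₀).ν)))⁻¹) / 2)
          * (Fintype.card ((𝓣 s₀).𝒦 (idx Z t)).Λ : ℝ)
        + K₀ 64 8 * c.α₄ * ((((Dfam Z t).image Subtype.val).biUnion id).card : ℝ)
        + (2 * (ϑ * (m * (1 + 2 / kap'') ^ (𝓣 s₀).ν)) +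
            (γ₂ + m' * c.α₄ * (c.M ^ 4)⁻¹ * (1 + 32 / (c.κ₁ - 1)) ^ 4)) * cE * (Fintype.card ((𝓣 s₀).𝒦 (idx Z t)).Λ : ℝ)
        + (2 * (ϑ * (m * (1 + 2 / kap'') ^ (𝓣 s₀).ν)) +
            (γ₂ + m' * c.α₄ * (c.M ^ 4)⁻¹ * (1 + 32 / (c.κ₁ - 1)) ^ 4)) * (1 + 2 * cE * (((rf.toWalkPackage R₁).BΓ * rf.cV) * ((rf.toWalkPackage R₁).BΓ * (m * B6.c0 1 rf.η ^ (𝓣 s₀).ν)) / (rf.mA₀ / 2)))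
            * (Fintype.card (((𝓣 s₀).𝒦 (idx Z t)).Λ ⊕ ((𝓣 s₀).𝒦 (idx Z t)).C₀) : ℝ)
        ≤ a₅ * ((Z.1).card : ℝ)) :
    B13.Lemma1Printed Wt.toStepData c ∧ B13.Lemma2Printed Wt.toStepData c ∧ B13.Lemma3Printed Wt.toStepData c := by
  have hmA2 : (rf.toWalkPackage R₁).mA = rf.mA₀ / 2 := rfl
  have hKCs' : 4 / (rf.toWalkPackage R₁).mA ≤ KCs := by
    rw [hmA2, div_div_eq_mul_div]; norm_num; exact hKCs
  have hcE' : 1 / (rf.toWalkPackage R₁).mA ≤ cE := by rw [hmA2, one_div_div]; exact hcE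
  exact b13Leaf_twoTorus_uniformWalksAcross₃ c 𝓣
    (uniformWalksAcross_of_ref hrf hall hR₁ hR₁R (margin_of_thresholds hrf.hR hPσ hP₁) (margin_of_thresholds hrf.hR hAσ hA₁))
    s₀ Wt k hN12 hL8 hLc S0 F Sq SX T Sc Sq' SX' T' dist h133 hS0Y hFsub
    hSq hScY hdist0 hdist hSX hSX' hX0 hAdd hZero hAnT hAnT' hK hK' hκ hδ1 hδκ hκ126 hκ126' hκ₁ hκ₁' hδ₀M hδ₀M5 hR8
    hR9 h124 h130 hθ0 hθ1 hC Gl hVpp hGlAn hGl rd e he hrd s Wf hg hK₂ hR h3 hW hKW hcard hV hQ hsp hvolk hfloor hAnP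
    hG M₃ hN h12 hE hε hC₁ hα hM hτ2 hUσ hUτ hUexp hUtau hr hr' hsubτ idx uOf hαnn huα lZ hlZ lD hlD Γm χY₀ χcP hχ0
    hχ1 Pl hPcard hrP hχc Dfam Vr hH ιb hι cube hQsupp hfibc emb hBv hBv0 hVr hχsupp hΨσ hΨτ hAs hlin hγ₂ hfibΛ hfibN
    (RefPackage.admissible_toWalkPackage hrf hR₁) hp hη hrf.hη hαR hKG hKCs' hθ₀ hαsmall hRσlarge hkap'' hk1 hk2 hk3 hk4
    hθ₀le hθR1le hsmallKθ hc0 hcE' hαc hsmall hPa hvol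

end Across

end Literature.MathematicalPhysics.QuantumFieldTheory.Balaban1983to89.B13NodeTorusWalksRefLeaves

end
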